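/-
Copyright (c) 2026 the pub-hodgecm-mathlib formalisation cell (harness21).  Prover seat hodgecm-mathlib-B-p08 (g41): unit U2G_Census (tier-1 assembler), tier-2 spine file 3:
the profile predicates of the ★ №3 pieces are LEVEL CLASS FUNCTIONS (congruence-stable) and `Ad GL₃(𝒪)`-stable — the inputs of `IsLocSmooth` ∕ `Ad K`-invariance; 2026-09-03.
-/
import Summits.HodgeConjecture.HodgeConjecture.Theorems.F0P3cDyRamProfileLabelTransport        -- ★ p854719 (B-p08 (g41)): `inLevel_conj_iff_latticeInLevel`, `valueSetMod_conj_eq_latticeValueSetMod`;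
                                                                                             -- brings ★ p854672 census defs, ★ №3 `InLevel ∕ NearTransvShell ∕ valueSetMod ∕ LabelPlus`, ★ `mapGL_stdLattice_eq_iff_mem_glInt`
import Literature.NumberTheory.Automorphic.UnitaryLatticeTreeCentralRescalingCountTransport  -- ★ `v_pairing_mulVec_le_of_map_le_scaleLattice` (`|⟨y, Ay⟩| ≤ |c|` when `A·M ⊆ c·M`, `M` a vertex, `y ∈ M`)
import Literature.NumberTheory.Automorphic.UnitaryLatticeTreeStarOfInvolution                -- ★ `isSelfDualLattice_stdLattice_three_of_v` (`𝒪³` is a type-0 vertex)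
import Literature.NumberTheory.Automorphic.UnitaryLatticeTreeTypeTwoGram                      -- ★ `isIntMatrix_mul`
import HarnessLib

/-!
# Crux `H413`, line LH4 «(D-RAM) FOUR-FRAME» road — unit U2G, TIER-2 SPINE 3: the profiles `InLevel`, `NearTransvShell`, `valueSetMod ∕ LabelPlus` are
# LEVEL CLASS FUNCTIONS on integral matrices (stable under `X ↦ X + D`, `D ∈ ϖⁿ·M₃(𝒪)`) and `Ad GL₃(𝒪) ∩ U`-STABLE

Cell `hodgecm-mathlib` (D-0151), FLOOR 0, crux item H413 = `stmt-HodgeConjecture-24833`, route of record `HCCMUnconditional`; squad F0∕P3c∕LH4 (req618); tier-1 unit U2G_Census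
(assembler B-p08 (g41)); also serves tier-1 unit U4_Rows (dealer LH4-plan (g10) WORD #16: `stub_U4_pieceProps_transvPlus ∕ transvMinus ∕ reg` = the `PiecePropsWild` conjuncts «smooth,
`K`-supported, `Ad K`-invariant, left-`K(ϖ^M)`-invariant» of the profile pieces).  THEOREMS ONLY (no `def`, no instance, no notation, no `sorry`); datum-free matrix algebra over a
field `K` with `Valued K ℤᵐ⁰` (+ `|σ·| = |·|` for the value sets); lane `--supports stmt-HodgeConjecture-24833 --as helper` (count-neutral).

WHY.  The profile pieces `f_{T+}, f_{T−}, f_reg` of ★ №3 (`pieceTransvPlus ∕ pieceTransvMinus ∕ pieceReg`) are indicators, inside `K = Stab(𝒪_w³)`, of sets cut out by the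
predicates `NearTransvShell ϖ ℓ m X`, `LabelPlus σ ϖ d m X` (= `valueSetMod σ ϖ m X = valueSetMod σ ϖ m xPlus`), `¬ InLevel ϖ m (X²)` of `X = wMatrix u − 1`.  Both the U2G
dictionaries (via ★ `classOrbitalIntegral_eq_sum_fixedBy_of_support_subset_of_conj_invariant`: `Continuous f`, `Ad K`-invariance) and U4-a (`IsLocSmooth`, `Ad K`, left-level
invariance) need exactly two facts about these predicates on INTEGRAL `X`: (i) they do not change under `X ↦ X + D` with `D ∈ ϖⁿ·M₃(𝒪)`, `n ≥` the levels read (a left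
translation `u ↦ Uu` by `U ≡ 1 (ϖⁿ)` changes `X = ι(u) − 1` by `D = (ι(U) − 1)·ι(u)`); (ii) they do not change under `X ↦ k⁻¹Xk` for `k ∈ GL₃(𝒪_w)` (unitary for the value sets) (an
`Ad K` conjugation).  (ii) is ★ p854719's transport at a `k` FIXING `𝒪³`; (i) is ultrametric bookkeeping (§1–§2), the value-set case through ★
`v_pairing_mulVec_le_of_map_le_scaleLattice` at the vertex `𝒪³`.

* §0 `inLevel_iff_isIntMatrix_smul` (`InLevel ϖ ℓ X ↔ IsIntMatrix ((ϖ^ℓ)⁻¹ • X)`), `inLevel_iff_latticeInLevel_stdLattice` (★ p854719 at `g = 1`), `inLevel_of_le` (monotone in `ℓ`).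
* §1 CONGRUENCE: `inLevel_add_iff_of_inLevel` (`D ∈ ϖⁿM₃(𝒪)`, `ℓ ≤ n` ⇒ `InLevel ℓ (X + D) ↔ InLevel ℓ X`), `inLevel_mul_of_isIntMatrix_left ∕ _right`,
  `inLevel_mul_self_add_iff` (`X, D` integral, `D ∈ ϖⁿM₃(𝒪)`, `m ≤ n` ⇒ `InLevel m ((X+D)²) ↔ InLevel m (X²)`), `nearTransvShell_add_iff`,
  `valueSetMod_add_eq` (`|σ·| = |·|`, `|ϖ| = exp(−1)`, `m ≤ n`), `labelPlus_add_iff`.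
* §2 `Ad`: `inLevel_units_conj_iff` (`k·𝒪³ = 𝒪³`), `nearTransvShell_units_conj_iff`, `valueSetMod_units_conj_eq` ∕ `labelPlus_units_conj_iff` (`k` unitary with `k·𝒪³ = 𝒪³`).
HONEST LABEL.  Count-neutral; the verdict of record for (D-RAM) stays PRINT [LanglandsShelstad1989 Thm. p. 484 ∕ Rogawski1990 Prop. 4.9.1 (a)] ∕ XL; `HC_CM` is proved only
modulo the 7 printed citations (2 remaining: hLiu418 = `stmt-HodgeConjecture-24832`, h413 = `stmt-HodgeConjecture-24833`) until rung 0 closes.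

## References
* [Kottwitz1986BaseChangeUnits] R. E. Kottwitz, *Base change for unit elements of Hecke algebras*, Compositio Math. 60 (1986), §1 pp. 240–241, §3 (congruence strata on the
  building; functions on `K` constant on level classes).
* [Rogawski1990] J. D. Rogawski, *Automorphic Representations of Unitary Groups in Three Variables*, Ann. of Math. Stud. 123 (1990), §1.6 p. 6 (`C_c^∞`), §4.9 pp. 54–55.
* [BernsteinZelevinsky1976] I. N. Bernstein, A. V. Zelevinsky, Russian Math. Surveys 31 (1976), §1.1 (locally constant functions: invariance under an open subgroup).
-/

noncomputable section

namespace Summit.HodgeConjecture.HodgeConjecture.Cruxes.H413.F0P3cDyRamProfileLevelClass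

open Literature.NumberTheory.Automorphic Literature.NumberTheory.Automorphic.HermitianLattice
  Literature.NumberTheory.Automorphic.UnitaryLatticeTree Literature.NumberTheory.Automorphic.UnitaryThreeFourFrame
open Summit.HodgeConjecture.HodgeConjecture.Cruxes.H413.F0P3cDyRamFourFramePieces
open Summit.HodgeConjecture.HodgeConjecture.Cruxes.H413.F0P3cDyRamFourFrameCensusDefs
open Summit.HodgeConjecture.HodgeConjecture.Cruxes.H413.F0P3cDyRamProfileLabelTransport
open scoped Valued WithZero Matrix MatrixGroups

variable {K : Type*} [Field K] [Valued K ℤᵐ⁰]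

/-! ## §0  Unfoldings -/

/-- `InLevel ϖ ℓ X ↔ (ϖ^ℓ)⁻¹·X ∈ M₃(𝒪)` (★ `IsIntMatrix`). [cite: Kottwitz1986BaseChangeUnits, §1 pp. 240–241] -/
theorem inLevel_iff_isIntMatrix_smul (ϖ : K) (ℓ : ℕ) (X : Matrix (Fin 3) (Fin 3) K) : InLevel ϖ ℓ X ↔ IsIntMatrix ((ϖ ^ ℓ)⁻¹ • X) := by
  refine forall_congr' fun a => forall_congr' fun b => ?_
  rw [Matrix.smul_apply, smul_eq_mul]

/-- `InLevel ϖ ℓ X ↔ LatticeInLevel ϖ ℓ X 𝒪³` (★ p854719 `inLevel_conj_iff_latticeInLevel` at `g = 1`). [cite: Kottwitz1986BaseChangeUnits, §1 pp. 240–241] -/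
theorem inLevel_iff_latticeInLevel_stdLattice {ϖ : K} (hϖ : ϖ ≠ 0) (ℓ : ℕ) (X : Matrix (Fin 3) (Fin 3) K) :
    InLevel ϖ ℓ X ↔ LatticeInLevel ϖ ℓ X (stdLattice K 3) := by
  have h := inLevel_conj_iff_latticeInLevel hϖ ℓ X (1 : GL (Fin 3) K)
  rwa [Units.val_one, inv_one, Matrix.one_mul, Matrix.mul_one, mapGL_one] at h

/-- Monotonicity: `InLevel ϖ n X`, `ℓ ≤ n`, `|ϖ| ≤ 1` ⇒ `InLevel ϖ ℓ X`. [cite: Kottwitz1986BaseChangeUnits, §1 pp. 240–241] -/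
theorem inLevel_of_le {ϖ : K} (hϖ : ϖ ≠ 0) (hϖ1 : Valued.v ϖ ≤ 1) {ℓ n : ℕ} (hln : ℓ ≤ n) {X : Matrix (Fin 3) (Fin 3) K} (h : InLevel ϖ n X) :
    InLevel ϖ ℓ X := by
  intro a b
  have hn : ϖ ^ n = ϖ ^ (n - ℓ) * ϖ ^ ℓ := by rw [← pow_add, Nat.sub_add_cancel hln]
  have e : (ϖ ^ ℓ)⁻¹ * X a b = ϖ ^ (n - ℓ) * ((ϖ ^ n)⁻¹ * X a b) := by
    rw [hn, mul_inv, ← mul_assoc, ← mul_assoc, mul_inv_cancel₀ (pow_ne_zero _ hϖ), one_mul]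
  rw [e, map_mul, map_pow]
  exact mul_le_one' (pow_le_one' hϖ1 _) (h a b)

/-! ## §1  Congruence: the profiles are level class functions on integral matrices -/

/-- `InLevel ℓ (X + D) ↔ InLevel ℓ X` when `D ∈ ϖⁿ·M₃(𝒪)` and `ℓ ≤ n` (ultrametric). [cite: Kottwitz1986BaseChangeUnits, §1 pp. 240–241] -/
theorem inLevel_add_iff_of_inLevel {ϖ : K} (hϖ : ϖ ≠ 0) (hϖ1 : Valued.v ϖ ≤ 1) {ℓ n : ℕ} (hln : ℓ ≤ n) {X D : Matrix (Fin 3) (Fin 3) K}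
    (hD : InLevel ϖ n D) : InLevel ϖ ℓ (X + D) ↔ InLevel ϖ ℓ X := by
  have hDℓ : InLevel ϖ ℓ D := inLevel_of_le hϖ hϖ1 hln hD
  constructor
  · intro h a b
    have e : (ϖ ^ ℓ)⁻¹ * X a b = (ϖ ^ ℓ)⁻¹ * (X + D) a b - (ϖ ^ ℓ)⁻¹ * D a b := by
      rw [Matrix.add_apply, mul_add, add_sub_cancel_right]
    rw [e]
    exact (Valuation.map_sub _ _ _).trans (max_le (h a b) (hDℓ a b))
  · intro h a b
    rw [Matrix.add_apply, mul_add]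
    exact (Valuation.map_add _ _ _).trans (max_le (h a b) (hDℓ a b))

/-- `InLevel n (A·B)` for `A` integral and `InLevel n B`. [cite: Kottwitz1986BaseChangeUnits, §1 pp. 240–241] -/
theorem inLevel_mul_of_isIntMatrix_left (ϖ : K) (n : ℕ) {A B : Matrix (Fin 3) (Fin 3) K} (hA : IsIntMatrix A) (hB : InLevel ϖ n B) :
    InLevel ϖ n (A * B) := by
  rw [inLevel_iff_isIntMatrix_smul] at hB ⊢
  rw [← Matrix.mul_smul]
  exact isIntMatrix_mul hA hB

/-- `InLevel n (A·B)` for `InLevel n A` and `B` integral. [cite: Kottwitz1986BaseChangeUnits, §1 pp. 240–241] -/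
theorem inLevel_mul_of_isIntMatrix_right (ϖ : K) (n : ℕ) {A B : Matrix (Fin 3) (Fin 3) K} (hA : InLevel ϖ n A) (hB : IsIntMatrix B) :
    InLevel ϖ n (A * B) := by
  rw [inLevel_iff_isIntMatrix_smul] at hA ⊢
  rw [← Matrix.smul_mul]
  exact isIntMatrix_mul hA hB

/-- The SQUARE is a level class function: `X`, `D` integral-ish (`X` integral, `D ∈ ϖⁿ·M₃(𝒪)` with `|ϖ| ≤ 1`), `m ≤ n` ⇒ `InLevel m ((X + D)²) ↔ InLevel m (X²)`
(`(X+D)² − X² = X·D + D·(X + D)`). [cite: Kottwitz1986BaseChangeUnits, §1 pp. 240–241] -/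
theorem inLevel_mul_self_add_iff {ϖ : K} (hϖ : ϖ ≠ 0) (hϖ1 : Valued.v ϖ ≤ 1) {m n : ℕ} (hmn : m ≤ n) {X D : Matrix (Fin 3) (Fin 3) K}
    (hX : IsIntMatrix X) (hD : InLevel ϖ n D) : InLevel ϖ m ((X + D) * (X + D)) ↔ InLevel ϖ m (X * X) := by
  have hDint : IsIntMatrix D := by
    intro a b
    have h := inLevel_of_le hϖ hϖ1 (Nat.zero_le n) hD a b
    rwa [pow_zero, inv_one, one_mul] at h
  have hXD : IsIntMatrix (X + D) := isIntMatrix_add hX hDint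
  have e : (X + D) * (X + D) = X * X + (X * D + D * (X + D)) := by
    rw [Matrix.add_mul, Matrix.mul_add, add_assoc]
  rw [e]
  refine inLevel_add_iff_of_inLevel hϖ hϖ1 hmn fun a b => ?_
  rw [Matrix.add_apply, mul_add]
  exact (Valuation.map_add _ _ _).trans
    (max_le (inLevel_mul_of_isIntMatrix_left ϖ n hX hD a b) (inLevel_mul_of_isIntMatrix_right ϖ n hD hXD a b))

/-- **THE SHELL IS A LEVEL CLASS FUNCTION**: for `X` integral, `D ∈ ϖⁿ·M₃(𝒪)`, `ℓ + 1 ≤ n`, `m ≤ n`: `NearTransvShell ϖ ℓ m (X + D) ↔ NearTransvShell ϖ ℓ m X`.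
[cite: Kottwitz1986BaseChangeUnits, §1 pp. 240–241] -/
theorem nearTransvShell_add_iff {ϖ : K} (hϖ : ϖ ≠ 0) (hϖ1 : Valued.v ϖ ≤ 1) {ℓ m n : ℕ} (hln : ℓ + 1 ≤ n) (hmn : m ≤ n) {X D : Matrix (Fin 3) (Fin 3) K}
    (hX : IsIntMatrix X) (hD : InLevel ϖ n D) : NearTransvShell ϖ ℓ m (X + D) ↔ NearTransvShell ϖ ℓ m X := by
  rw [NearTransvShell, NearTransvShell, inLevel_add_iff_of_inLevel hϖ hϖ1 ((Nat.le_succ ℓ).trans hln) hD, inLevel_add_iff_of_inLevel hϖ hϖ1 hln hD,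
    inLevel_mul_self_add_iff hϖ hϖ1 hmn hX hD]

/-- **THE VALUE SET IS A LEVEL CLASS FUNCTION**: for `|σ·| = |·|`, `|ϖ| = exp(−1)`, `D ∈ ϖⁿ·M₃(𝒪)` and `m ≤ n`: `valueSetMod σ ϖ m (X + D) = valueSetMod σ ϖ m X`
(`⟨y, (X+D)y⟩ − ⟨y, Xy⟩ = ⟨y, Dy⟩ ∈ ϖⁿ𝒪` for integral `y`, ★ `v_pairing_mulVec_le_of_map_le_scaleLattice` at the vertex `𝒪³`). [cite: Kottwitz1986BaseChangeUnits, §1 pp. 240–241]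
[cite: Rogawski1990, §4.9 Prop. 4.9.1 (b) p. 55] -/
theorem valueSetMod_add_eq {σ : K →+* K} (hvσ : ∀ a, Valued.v (σ a) = Valued.v a) {ϖ : K} (hϖ : Valued.v ϖ = WithZero.exp (-1 : ℤ)) {m n : ℕ} (hmn : m ≤ n)
    (X : Matrix (Fin 3) (Fin 3) K) {D : Matrix (Fin 3) (Fin 3) K} (hD : InLevel ϖ n D) : valueSetMod σ ϖ m (X + D) = valueSetMod σ ϖ m X := by
  have hϖ0 : ϖ ≠ 0 := fun h => by rw [h, map_zero] at hϖ; exact WithZero.coe_ne_zero hϖ.symm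
  have hϖ1 : Valued.v ϖ ≤ 1 := by rw [hϖ, ← WithZero.exp_zero, WithZero.exp_le_exp]; norm_num
  -- `⟨y, Dy⟩ ∈ ϖ^m 𝒪` for integral `y`
  have hDm : LatticeInLevel ϖ m D (stdLattice K 3) := (inLevel_iff_latticeInLevel_stdLattice hϖ0 m D).1 (inLevel_of_le hϖ0 hϖ1 hmn hD)
  have hstd : IsVertexLattice σ ϖ ((StdForm.antidiagonal 3).over K) 0 (stdLattice K 3) := isSelfDualLattice_stdLattice_three_of_v hϖ
  have hval : ∀ y : Fin 3 → K, (∀ a, Valued.v (y a) ≤ 1) →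
      Valued.v ((ϖ ^ m)⁻¹ * pairing σ ((StdForm.antidiagonal 3).over K) y (D.mulVec y)) ≤ 1 := by
    intro y hy
    have hy' : y ∈ stdLattice K 3 := (mem_stdLattice).2 hy
    have h := v_pairing_mulVec_le_of_map_le_scaleLattice hvσ hstd (pow_ne_zero m hϖ0) hDm hy'
    rw [map_mul, map_inv₀]
    exact (inv_mul_le_one₀ ((Valuation.pos_iff _).2 (pow_ne_zero m hϖ0))).2 h
  -- the two thickened sets coincide
  have key : ∀ (z : K) (y : Fin 3 → K), (∀ a, Valued.v (y a) ≤ 1) →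
      (Valued.v ((ϖ ^ m)⁻¹ * (z - pairing σ ((StdForm.antidiagonal 3).over K) y ((X + D).mulVec y))) ≤ 1 ↔
        Valued.v ((ϖ ^ m)⁻¹ * (z - pairing σ ((StdForm.antidiagonal 3).over K) y (X.mulVec y))) ≤ 1) := by
    intro z y hy
    have e : (ϖ ^ m)⁻¹ * (z - pairing σ ((StdForm.antidiagonal 3).over K) y ((X + D).mulVec y)) =
        (ϖ ^ m)⁻¹ * (z - pairing σ ((StdForm.antidiagonal 3).over K) y (X.mulVec y)) - (ϖ ^ m)⁻¹ * pairing σ ((StdForm.antidiagonal 3).over K) y (D.mulVec y) := by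
      rw [Matrix.add_mulVec, map_add]; ring
    constructor
    · intro h
      have e' : (ϖ ^ m)⁻¹ * (z - pairing σ ((StdForm.antidiagonal 3).over K) y (X.mulVec y)) =
          (ϖ ^ m)⁻¹ * (z - pairing σ ((StdForm.antidiagonal 3).over K) y ((X + D).mulVec y)) + (ϖ ^ m)⁻¹ * pairing σ ((StdForm.antidiagonal 3).over K) y (D.mulVec y) := by
        rw [e, sub_add_cancel]
      rw [e']
      exact (Valuation.map_add _ _ _).trans (max_le h (hval y hy))
    · intro h
      rw [e]
      exact (Valuation.map_sub _ _ _).trans (max_le h (hval y hy))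
  ext z
  simp only [valueSetMod, Set.mem_setOf_eq]
  constructor
  · rintro ⟨y, hy, hz⟩
    exact ⟨y, hy, (key z y hy).1 hz⟩
  · rintro ⟨y, hy, hz⟩
    exact ⟨y, hy, (key z y hy).2 hz⟩

/-- **THE LABEL IS A LEVEL CLASS FUNCTION**: `LabelPlus σ ϖ d m (X + D) ↔ LabelPlus σ ϖ d m X` under the hypotheses of `valueSetMod_add_eq`. [cite: Kottwitz1986BaseChangeUnits, §1 pp. 240–241] -/
theorem labelPlus_add_iff {σ : K →+* K} (hvσ : ∀ a, Valued.v (σ a) = Valued.v a) {ϖ : K} (hϖ : Valued.v ϖ = WithZero.exp (-1 : ℤ)) {m n : ℕ} (hmn : m ≤ n)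
    (d : ℕ) (X : Matrix (Fin 3) (Fin 3) K) {D : Matrix (Fin 3) (Fin 3) K} (hD : InLevel ϖ n D) : LabelPlus σ ϖ d m (X + D) ↔ LabelPlus σ ϖ d m X := by
  rw [LabelPlus, LabelPlus, valueSetMod_add_eq hvσ hϖ hmn X hD]

/-! ## §2  `Ad`: conjugation by `k ∈ GL₃(𝒪)` (unitary for the value sets) preserves the profiles -/

/-- `InLevel ϖ ℓ (k⁻¹Xk) ↔ InLevel ϖ ℓ X` for `k` with `k·𝒪³ = 𝒪³` (`k ∈ GL₃(𝒪)`), via ★ p854719's transport. [cite: Kottwitz1986BaseChangeUnits, §1 pp. 240–241] -/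
theorem inLevel_units_conj_iff {ϖ : K} (hϖ : ϖ ≠ 0) (ℓ : ℕ) (X : Matrix (Fin 3) (Fin 3) K) {k : GL (Fin 3) K} (hk : mapGL k (stdLattice K 3) = stdLattice K 3) :
    InLevel ϖ ℓ ((k : Matrix (Fin 3) (Fin 3) K)⁻¹ * X * (k : Matrix (Fin 3) (Fin 3) K)) ↔ InLevel ϖ ℓ X := by
  rw [inLevel_conj_iff_latticeInLevel hϖ ℓ X k, hk, inLevel_iff_latticeInLevel_stdLattice hϖ]

/-- `NearTransvShell ϖ ℓ m (k⁻¹Xk) ↔ NearTransvShell ϖ ℓ m X` for `k·𝒪³ = 𝒪³`. [cite: Kottwitz1986BaseChangeUnits, §1 pp. 240–241] -/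
theorem nearTransvShell_units_conj_iff {ϖ : K} (hϖ : ϖ ≠ 0) (ℓ m : ℕ) (X : Matrix (Fin 3) (Fin 3) K) {k : GL (Fin 3) K} (hk : mapGL k (stdLattice K 3) = stdLattice K 3) :
    NearTransvShell ϖ ℓ m ((k : Matrix (Fin 3) (Fin 3) K)⁻¹ * X * (k : Matrix (Fin 3) (Fin 3) K)) ↔ NearTransvShell ϖ ℓ m X := by
  have h1 := nearTransvShell_conj_iff_latticeNearTransvShell hϖ ℓ m X k
  have h0 := nearTransvShell_conj_iff_latticeNearTransvShell hϖ ℓ m X (1 : GL (Fin 3) K)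
  rw [Units.val_one, inv_one, Matrix.one_mul, Matrix.mul_one, mapGL_one] at h0
  rw [h1, hk, h0]

/-- `valueSetMod σ ϖ m (k⁻¹Xk) = valueSetMod σ ϖ m X` for `k ∈ U(σ, Φ₃)` with `k·𝒪³ = 𝒪³`. [cite: Rogawski1990, §4.9 Prop. 4.9.1 (b) p. 55] -/
theorem valueSetMod_units_conj_eq (σ : K →+* K) (ϖ : K) (m : ℕ) (X : Matrix (Fin 3) (Fin 3) K) {k : GL (Fin 3) K}
    (hkU : k ∈ unitaryGroupOfForm σ ((StdForm.antidiagonal 3).over K)) (hk : mapGL k (stdLattice K 3) = stdLattice K 3) :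
    valueSetMod σ ϖ m ((k : Matrix (Fin 3) (Fin 3) K)⁻¹ * X * (k : Matrix (Fin 3) (Fin 3) K)) = valueSetMod σ ϖ m X := by
  have h1 := valueSetMod_conj_eq_latticeValueSetMod σ ϖ m X hkU
  have h0 := valueSetMod_conj_eq_latticeValueSetMod σ ϖ m X (Subgroup.one_mem (unitaryGroupOfForm σ ((StdForm.antidiagonal 3).over K)))
  rw [Units.val_one, inv_one, Matrix.one_mul, Matrix.mul_one, mapGL_one] at h0
  rw [h1, hk, h0]

/-- `LabelPlus σ ϖ d m (k⁻¹Xk) ↔ LabelPlus σ ϖ d m X` for `k ∈ U(σ, Φ₃)` with `k·𝒪³ = 𝒪³`. [cite: Rogawski1990, §4.9 Prop. 4.9.1 (b) p. 55] -/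
theorem labelPlus_units_conj_iff (σ : K →+* K) (ϖ : K) (d m : ℕ) (X : Matrix (Fin 3) (Fin 3) K) {k : GL (Fin 3) K}
    (hkU : k ∈ unitaryGroupOfForm σ ((StdForm.antidiagonal 3).over K)) (hk : mapGL k (stdLattice K 3) = stdLattice K 3) :
    LabelPlus σ ϖ d m ((k : Matrix (Fin 3) (Fin 3) K)⁻¹ * X * (k : Matrix (Fin 3) (Fin 3) K)) ↔ LabelPlus σ ϖ d m X := by
  rw [LabelPlus, LabelPlus, valueSetMod_units_conj_eq σ ϖ m X hkU hk]

end Summit.HodgeConjecture.HodgeConjecture.Cruxes.H413.F0P3cDyRamProfileLevelClass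

end
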